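import Mathlib
import Literature.Analysis.FluidPDE.PassiveScalarSteadyTest
import Literature.Analysis.FluidPDE.PassiveScalarEnergyProofs
import Literature.Analysis.FluidPDE.PassiveScalarFourier
import Literature.Analysis.FluidPDE.EnergyToolkit
import Summits.AnomalousDissipation.AnomalousDissipation.Theorems.LimitingAbsorptionKinematicSteadySourceLawToolkit
import HarnessLib

/-!
# Negative knowledge for the crux `FloorUpgrade` (stmt-AnomalousDissipation-15010), III:
# the ballistic short-lag bound (B1) — a release cannot decorrelate faster than it is swept

Route `route-AnomalousDissipation-LimitingAbsorption`, crux r4 `…Theses.LimitingAbsorption.FloorUpgrade`;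
supports stmt-AnomalousDissipation-15010 (refuter / crux-disprover lane; no route statement concluded).
This is the one PDE input of the transport speed limit of Part I (`FastClassEmpty`): with it, the kill
of the FAST relaxing-family class of line `SketchIdeator1` becomes unconditional. It is also, verbatim,
the lead's stub `stub_ballistic` (line `SketchIdeator1`, B1), landed here as a helper.

`ballistic_bound`: for `κ > 0`, a smooth profile `h` with `‖Δh‖₂ ≤ Dh`, a drift `u` essentially
bounded on `(0,T) × T^d` and a weak solution `θ` (tree class `Torus.IsWeakScalarTransportOn`) of
`∂ₜθ + u·∇θ = κΔθ`, `θ(0) = h` on `[0,T)`, for a.e. `s ∈ (0,T)`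

  `‖h‖² - ⟨h, θ(s)⟩ ≤ 2κ s ‖h‖ Dh + 2 (∫₀ˢ ‖u(τ)·∇h‖₂ dτ)²`.

Proof. Test the equation against the steady field `h` (`IsWeakScalarTransportOn.ae_integral_mul_eq`):
`m(s) := ‖h‖² - ⟨h,θ(s)⟩ = -∫₀ˢ ∫ θ (u·∇h + κΔh)` for a.e. `s`. At a.e. `τ`: `∫ h (u·∇h) = 0` (weak
incompressibility, `Torus.integral_mul_inner_gradient_eq_zero`), so
`-∫ θ u·∇h = ∫ (h - θ) u·∇h ≤ ‖θ(τ) - h‖₂ ‖u(τ)·∇h‖₂ ≤ √(2m(τ)) k(τ)` by Cauchy–Schwarz and the `L²`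
contraction `‖θ(τ)‖² ≤ ‖h‖²` (`KinematicSteadySourceLaw.ae_scalarL2Sq_le`), and
`-κ∫θΔh ≤ κ‖h‖ Dh`. Hence `m(s) ≤ Ψ(s) := κ‖h‖Dh s + ∫₀ˢ √(2m) k` a.e.; `Ψ` is monotone, so
`∫₀ˢ √(2m) k ≤ √(2Ψ(s)) ∫₀ˢ k` and `x ≤ a + √(2x) F ⇒ x ≤ 2a + 2F²` closes.

## References

* R. J. DiPerna, P.-L. Lions, Invent. Math. 98 (1989), §II.1 (13)–(14) (weak formulation tested
  against `η(t) g(x)`). [`DiPernaLions1989`]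
* T. D. Drivas, T. M. Elgindi, G. Iyer, I.-J. Jeong, ARMA 243 (2022), (1.3) (`L²` balance).
  [`DEIJ2022`]
-/

noncomputable section

open MeasureTheory Set Filter Function TopologicalSpace Topology
open scoped ENNReal NNReal InnerProductSpace

namespace Summit.AnomalousDissipation.AnomalousDissipation.Theorems.FloorUpgrade.Negative

set_option linter.dupNamespace false -- D-0017: `Summit.<S>.<S>.…` namespace by design

open Literature.Analysis Literature.Analysis.FluidPDE Literature.Analysis.FluidPDE.Torus

variable {d : Type*} [Fintype d]

/-! ## Two elementary lemmas -/

/-- `x ≤ a + √(2x)·F` with `a, F ≥ 0` forces `x ≤ 2a + 2F²` (`√(2x) F ≤ x/2 + F²`). [folklore] -/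
theorem le_two_mul_add_of_le_add_sqrt_mul {x a F : ℝ} (ha : 0 ≤ a)
    (h : x ≤ a + Real.sqrt (2 * x) * F) : x ≤ 2 * a + 2 * F ^ 2 := by
  rcases le_or_gt x 0 with hx | hx
  · nlinarith [sq_nonneg F]
  · have hs : Real.sqrt (2 * x) * F ≤ x / 2 + F ^ 2 := by
      have h2x : 0 ≤ 2 * x := by linarith
      nlinarith [Real.sq_sqrt h2x, sq_nonneg (Real.sqrt (2 * x) - 2 * F), Real.sqrt_nonneg (2 * x)]
    linarith

/-- The expansion `‖θ - h‖² = ‖θ‖² - 2⟨h, θ⟩ + ‖h‖²` for `L²` slices. [folklore] -/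
theorem integral_sub_sq_eq {θ h : UnitAddTorus d → ℝ} (hθ : MemLp θ 2 volume) (hh : MemLp h 2 volume) :
    ∫ x, (h x - θ x) ^ 2 = scalarL2Sq θ - 2 * (∫ x, h x * θ x) + scalarL2Sq h := by
  have i1 : Integrable (fun x => θ x ^ 2) volume := hθ.integrable_sq
  have i2 : Integrable (fun x => h x ^ 2) volume := hh.integrable_sq
  have i3 : Integrable (fun x => h x * θ x) volume := memLp_one_iff_integrable.1 (hθ.mul' hh)
  have e : (fun x => (h x - θ x) ^ 2) = fun x => θ x ^ 2 - 2 * (h x * θ x) + h x ^ 2 := by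
    funext x; ring
  have i4 : Integrable (fun x => θ x ^ 2 - 2 * (h x * θ x)) volume := i1.sub (i3.const_mul 2)
  rw [e, integral_add i4 i2, integral_sub i1 (i3.const_mul 2), integral_const_mul]
  unfold scalarL2Sq
  ring

/-! ## The ballistic bound -/

/-- Product-measure form of the essential bound of the drift. [folklore] -/
theorem ae_prod_norm_le_of_memLp_top_stLift {u : ℝ → UnitAddTorus d → EuclideanSpace ℝ d} {T : ℝ}
    (hu : MemLp (FunctionSpaces.Torus.stLift u) ∞ (volume.restrict (Ioo 0 T ×ˢ univ))) :
    ∃ C : ℝ, 0 ≤ C ∧ ∀ᵐ q : ℝ × UnitAddTorus d ∂(((volume : Measure ℝ).restrict (Ioo 0 T)).prod volume),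
      ‖u q.1 q.2‖ ≤ C := by
  set μ' : Measure (ℝ × EuclideanSpace ℝ d) := volume.restrict (Ioo 0 T ×ˢ univ) with hμ'
  set C : ℝ := (eLpNorm (FunctionSpaces.Torus.stLift u) ∞ μ').toReal with hC
  have hfin : eLpNorm (FunctionSpaces.Torus.stLift u) ∞ μ' < (⊤ : ℝ≥0∞) := hu.eLpNorm_lt_top
  have hae' : ∀ᵐ p ∂μ', ‖FunctionSpaces.Torus.stLift u p‖ ≤ C := by
    filter_upwards [ae_le_eLpNormEssSup (f := FunctionSpaces.Torus.stLift u) (μ := μ')] with p hp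
    rw [← eLpNorm_exponent_top] at hp
    have := ENNReal.toReal_mono hfin.ne hp
    rwa [toReal_enorm] at this
  refine ⟨C, ENNReal.toReal_nonneg, ?_⟩
  have hprod : μ' = ((volume : Measure ℝ).restrict (Ioo 0 T)).prod volume := by
    rw [hμ', Measure.volume_eq_prod, ← Measure.prod_restrict, Measure.restrict_univ]
  rw [hprod] at hae'
  have hq := MeasureTheory.QuasiMeasurePreserving.prodMap
    (Measure.QuasiMeasurePreserving.id ((volume : Measure ℝ).restrict (Ioo 0 T)))
    (FunctionSpaces.Torus.quasiMeasurePreserving_repr (d := d))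
  filter_upwards [hq.ae hae'] with q hq'
  simpa [FunctionSpaces.Torus.stLift] using hq'

set_option maxHeartbeats 800000 in
/-- **The ballistic short-lag bound (B1; the lead's `stub_ballistic`, general dimension).**
For `κ > 0`, a smooth profile `h` with `‖Δh‖₂ ≤ Dh`, an essentially bounded drift `u` on
`(0,T) × T^d` and a weak solution `θ` of `∂ₜθ + u·∇θ = κΔθ`, `θ(0) = h` on `[0,T)`:
`‖h‖² - ⟨h, θ(s)⟩ ≤ 2κ s ‖h‖ Dh + 2 (∫₀ˢ ‖u(τ)·∇h‖₂ dτ)²` for a.e. `s ∈ (0,T)`. [folklore] -/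
theorem ballistic_bound (κ T Dh : ℝ) (u : ℝ → UnitAddTorus d → EuclideanSpace ℝ d)
    (h : UnitAddTorus d → ℝ) (θ : ℝ → UnitAddTorus d → ℝ) (hκ : 0 < κ)
    (hh : FunctionSpaces.Torus.IsSmooth h) (hDh : 0 ≤ Dh)
    (hΔ : scalarL2Sq (FunctionSpaces.Torus.laplacian h) ≤ Dh ^ 2)
    (hu : MemLp (FunctionSpaces.Torus.stLift u) ⊤ (volume.restrict (Ioo (0 : ℝ) T ×ˢ univ)))
    (hθ : IsWeakScalarTransportOn T κ u h θ) :
    ∀ᵐ s ∂(volume.restrict (Ioo (0 : ℝ) T)),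
      scalarL2Sq h - ∫ x, h x * θ s x ≤
        2 * κ * s * Real.sqrt (scalarL2Sq h) * Dh +
        2 * (∫ τ in Ioo (0 : ℝ) s, Real.sqrt (∫ x,
              (⟪u τ x, FunctionSpaces.Torus.gradient h x⟫_ℝ) ^ 2)) ^ 2 := by
  -- notation
  set L : ℝ := scalarL2Sq h with hLdef
  have hL0 : 0 ≤ L := scalarL2Sq_nonneg h
  set k : ℝ → ℝ := fun τ => Real.sqrt (∫ x, (⟪u τ x, FunctionSpaces.Torus.gradient h x⟫_ℝ) ^ 2)
    with hkdef
  have hk0 : ∀ τ, 0 ≤ k τ := fun τ => Real.sqrt_nonneg _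
  set m : ℝ → ℝ := fun s => L - ∫ x, h x * θ s x with hmdef
  set Φ : ℝ → ℝ := fun τ => ∫ x, θ τ x *
    (⟪u τ x, FunctionSpaces.Torus.gradient h x⟫_ℝ + κ * FunctionSpaces.Torus.laplacian h x) with hΦdef
  set μT : Measure ℝ := (volume : Measure ℝ).restrict (Ioo 0 T) with hμT
  have hhL2 : MemLp h 2 volume := hh.memLp 2
  have hΔL2 : MemLp (FunctionSpaces.Torus.laplacian h) 2 volume := hh.laplacian.memLp 2
  obtain ⟨G, hG⟩ := FunctionSpaces.Torus.exists_forall_norm_le_of_continuous hh.gradient.continuous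
  have hG0 : 0 ≤ G := (norm_nonneg _).trans (hG 0)
  obtain ⟨M, hM0, hM⟩ := ae_prod_norm_le_of_memLp_top_stLift hu
  have hMslice : ∀ᵐ τ ∂μT, ∀ᵐ x ∂volume, ‖u τ x‖ ≤ M := Measure.ae_ae_of_ae_prod hM
  /- Step 1: the identity `m s = -∫_{(0,s]} Φ` for a.e. `s`. -/
  have hid : ∀ᵐ s ∂μT, m s = -∫ τ in Ioc 0 s, Φ τ := by
    filter_upwards [hθ.ae_integral_mul_eq hh] with s hs
    have e1 : ∫ x, h x * θ s x = ∫ x, θ s x * h x :=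
      integral_congr_ae (Eventually.of_forall fun x => mul_comm _ _)
    have e2 : ∫ x, h x * h x = L := by
      rw [hLdef]; unfold scalarL2Sq
      exact integral_congr_ae (Eventually.of_forall fun x => by ring)
    simp only [hmdef, hΦdef]
    rw [e1, hs, e2]
    ring
  /- Step 2: pointwise bound `-Φ τ ≤ κ √L Dh + √(2 m τ) k τ` and `0 ≤ m τ` for a.e. `τ`. -/
  have hcontr := KinematicSteadySourceLaw.ae_scalarL2Sq_le hκ hθ hhL2 hu
  have hint1 := (hθ.integrable_mul_inner_continuous hh.gradient.continuous).prod_right_ae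
  have hint2 := (hθ.integrable_mul_continuous
    (c := fun x => κ * FunctionSpaces.Torus.laplacian h x)
    (continuous_const.mul hh.laplacian.continuous)).prod_right_ae
  have hpt : ∀ᵐ τ ∂μT, -Φ τ ≤ κ * Real.sqrt L * Dh + Real.sqrt (2 * m τ) * k τ ∧ 0 ≤ m τ := by
    filter_upwards [hθ.ae_memLp_two, hcontr, hθ.ae_isWeaklyDivFree,
      hθ.ae_aestronglyMeasurable_velocity_slice, hMslice, hint1, hint2]
      with τ hmem hcon hdiv husm huM hi1 hi2
    -- the slice `w = u(τ)·∇h` is in `L²`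
    set w : UnitAddTorus d → ℝ := fun x => ⟪u τ x, FunctionSpaces.Torus.gradient h x⟫_ℝ with hw
    have hwm : AEStronglyMeasurable w volume :=
      husm.inner hh.gradient.continuous.aestronglyMeasurable
    have hwbd : ∀ᵐ x ∂volume, ‖w x‖ ≤ M * G := by
      filter_upwards [huM] with x hx
      calc ‖w x‖ ≤ ‖u τ x‖ * ‖FunctionSpaces.Torus.gradient h x‖ := norm_inner_le_norm _ _
        _ ≤ M * G := mul_le_mul hx (hG x) (norm_nonneg _) hM0
    have hwL2 : MemLp w 2 volume := (memLp_top_of_bound hwm (M * G) hwbd).mono_exponent le_top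
    -- `∫ (h - θ τ)² ≤ 2 m τ`
    have hsubL2 : MemLp (fun x => h x - θ τ x) 2 volume := hhL2.sub hmem
    have hCS0 : ∫ x, h x * θ τ x ≤ Real.sqrt L * Real.sqrt (scalarL2Sq (θ τ)) :=
      integral_mul_le_sqrt_mul_sqrt_of_memLp hhL2 hmem
    have hsq : ∫ x, (h x - θ τ x) ^ 2 ≤ 2 * m τ := by
      have hcon' : scalarL2Sq (θ τ) ≤ L := by rw [hLdef]; exact hcon
      have e := integral_sub_sq_eq hmem hhL2
      rw [← hLdef] at e
      have em : m τ = L - ∫ x, h x * θ τ x := rfl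
      rw [e, em]
      linarith
    have hm0 : 0 ≤ m τ := by
      have : 0 ≤ ∫ x, (h x - θ τ x) ^ 2 := integral_nonneg fun x => sq_nonneg _
      linarith
    -- the transport term
    have hcancel : ∫ x, h x * w x = 0 := integral_mul_inner_gradient_eq_zero hh hdiv
    have hi3 : Integrable (fun x => h x * w x) volume := memLp_one_iff_integrable.1 (hwL2.mul' hhL2)
    have hi4 : Integrable (fun x => θ τ x * w x) volume := memLp_one_iff_integrable.1 (hwL2.mul' hmem)
    have htrans : -∫ x, θ τ x * w x ≤ Real.sqrt (2 * m τ) * k τ := by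
      have e : -∫ x, θ τ x * w x = ∫ x, (h x - θ τ x) * w x := by
        have : (fun x => (h x - θ τ x) * w x) = fun x => h x * w x - θ τ x * w x := by
          funext x; ring
        rw [this, integral_sub hi3 hi4, hcancel]
        ring
      rw [e]
      have hcs := integral_mul_le_sqrt_mul_sqrt_of_memLp hsubL2 hwL2
      calc ∫ x, (h x - θ τ x) * w x
          ≤ Real.sqrt (∫ x, (h x - θ τ x) ^ 2) * Real.sqrt (∫ x, w x ^ 2) := hcs
        _ ≤ Real.sqrt (2 * m τ) * k τ := by
            have h1 : Real.sqrt (∫ x, (h x - θ τ x) ^ 2) ≤ Real.sqrt (2 * m τ) := Real.sqrt_le_sqrt hsq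
            have h2 : Real.sqrt (∫ x, w x ^ 2) = k τ := rfl
            rw [h2]
            exact mul_le_mul_of_nonneg_right h1 (hk0 τ)
    -- the viscous term
    have hvisc : -(∫ x, θ τ x * (κ * FunctionSpaces.Torus.laplacian h x)) ≤ κ * Real.sqrt L * Dh := by
      have e : ∫ x, θ τ x * (κ * FunctionSpaces.Torus.laplacian h x) =
          κ * ∫ x, -θ τ x * -FunctionSpaces.Torus.laplacian h x := by
        rw [← integral_const_mul]
        exact integral_congr_ae (Eventually.of_forall fun x => by ring)
      have hnegθ : MemLp (fun x => -θ τ x) 2 volume := hmem.neg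
      have hcs := integral_mul_le_sqrt_mul_sqrt_of_memLp hnegθ hΔL2
      have h1 : Real.sqrt (∫ x, (-θ τ x) ^ 2) ≤ Real.sqrt L := by
        refine Real.sqrt_le_sqrt ?_
        have : (fun x => (-θ τ x) ^ 2) = fun x => θ τ x ^ 2 := by funext x; ring
        rw [this]; exact hcon
      have h2 : Real.sqrt (∫ x, FunctionSpaces.Torus.laplacian h x ^ 2) ≤ Dh := by
        calc Real.sqrt (∫ x, FunctionSpaces.Torus.laplacian h x ^ 2) ≤ Real.sqrt (Dh ^ 2) :=
              Real.sqrt_le_sqrt hΔ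
          _ = Dh := Real.sqrt_sq hDh
      have e2 : -(∫ x, θ τ x * (κ * FunctionSpaces.Torus.laplacian h x)) =
          κ * ∫ x, (-θ τ x) * FunctionSpaces.Torus.laplacian h x := by
        rw [e, ← mul_neg, ← integral_neg]
        congr 1
        exact integral_congr_ae (Eventually.of_forall fun x => by ring)
      rw [e2, mul_assoc]
      refine mul_le_mul_of_nonneg_left ?_ hκ.le
      calc ∫ x, (-θ τ x) * FunctionSpaces.Torus.laplacian h x
          ≤ Real.sqrt (∫ x, (-θ τ x) ^ 2) * Real.sqrt (∫ x, FunctionSpaces.Torus.laplacian h x ^ 2) := hcs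
        _ ≤ Real.sqrt L * Dh := mul_le_mul h1 h2 (Real.sqrt_nonneg _) (Real.sqrt_nonneg _)
    -- assemble
    refine ⟨?_, hm0⟩
    have esplit : Φ τ = (∫ x, θ τ x * w x) + ∫ x, θ τ x * (κ * FunctionSpaces.Torus.laplacian h x) := by
      simp only [hΦdef, hw]
      rw [← integral_add hi1 hi2]
      exact integral_congr_ae (Eventually.of_forall fun x => by ring)
    rw [esplit]
    linarith
  /- Step 3: integrate — `m s ≤ Ψ s := κ √L Dh s + ∫_{(0,s]} √(2 m) k` for a.e. `s`. -/
  -- integrability of `Φ`, `k`, and of the comparison integrand on `(0,T)`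
  have hΦint : Integrable Φ μT := (hθ.integrable_mul_steadyFlux hh).integral_prod_left
  have hFprod : Integrable (fun q : ℝ × UnitAddTorus d =>
      (⟪u q.1 q.2, FunctionSpaces.Torus.gradient h q.2⟫_ℝ) ^ 2) (μT.prod volume) := by
    have hm1 : AEStronglyMeasurable (fun q : ℝ × UnitAddTorus d =>
        (⟪u q.1 q.2, FunctionSpaces.Torus.gradient h q.2⟫_ℝ) ^ 2) (μT.prod volume) :=
      (hθ.aestronglyMeasurable_uncurry_velocity.inner
        (hh.gradient.continuous.comp continuous_snd).aestronglyMeasurable).pow 2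
    haveI : IsFiniteMeasure μT := ⟨by
      rw [hμT, Measure.restrict_apply_univ]; exact measure_Ioo_lt_top⟩
    refine ⟨hm1, (hasFiniteIntegral_const ((M * G) ^ 2)).mono ?_⟩
    filter_upwards [hM] with q hq
    rw [Real.norm_eq_abs, abs_of_nonneg (sq_nonneg _), Real.norm_eq_abs, abs_of_nonneg (sq_nonneg _)]
    have h1 : |⟪u q.1 q.2, FunctionSpaces.Torus.gradient h q.2⟫_ℝ| ≤ M * G :=
      (abs_real_inner_le_norm _ _).trans (mul_le_mul hq (hG _) (norm_nonneg _) hM0)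
    calc (⟪u q.1 q.2, FunctionSpaces.Torus.gradient h q.2⟫_ℝ) ^ 2
        = |⟪u q.1 q.2, FunctionSpaces.Torus.gradient h q.2⟫_ℝ| ^ 2 := (sq_abs _).symm
      _ ≤ (M * G) ^ 2 := pow_le_pow_left₀ (abs_nonneg _) h1 2
  have hk_meas : AEStronglyMeasurable k μT :=
    Real.continuous_sqrt.comp_aestronglyMeasurable hFprod.integral_prod_left.aestronglyMeasurable
  have hk_bd : ∀ᵐ τ ∂μT, k τ ≤ M * G := by
    filter_upwards [Measure.ae_ae_of_ae_prod hM] with τ hτ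
    have h1 : ∫ x, (⟪u τ x, FunctionSpaces.Torus.gradient h x⟫_ℝ) ^ 2 ≤
        ∫ _x : UnitAddTorus d, (M * G) ^ 2 := by
      refine integral_mono_of_nonneg (Eventually.of_forall fun x => sq_nonneg _) (integrable_const _) ?_
      filter_upwards [hτ] with x hx
      have h1 : |⟪u τ x, FunctionSpaces.Torus.gradient h x⟫_ℝ| ≤ M * G :=
        (abs_real_inner_le_norm _ _).trans (mul_le_mul hx (hG _) (norm_nonneg _) hM0)
      calc (⟪u τ x, FunctionSpaces.Torus.gradient h x⟫_ℝ) ^ 2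
          = |⟪u τ x, FunctionSpaces.Torus.gradient h x⟫_ℝ| ^ 2 := (sq_abs _).symm
        _ ≤ (M * G) ^ 2 := pow_le_pow_left₀ (abs_nonneg _) h1 2
    rw [integral_const, smul_eq_mul, measureReal_def, measure_univ, ENNReal.toReal_one, one_mul] at h1
    calc k τ = Real.sqrt (∫ x, (⟪u τ x, FunctionSpaces.Torus.gradient h x⟫_ℝ) ^ 2) := rfl
      _ ≤ Real.sqrt ((M * G) ^ 2) := Real.sqrt_le_sqrt h1
      _ = M * G := Real.sqrt_sq (mul_nonneg hM0 hG0)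
  haveI hμTfin : IsFiniteMeasure μT := ⟨by
    rw [hμT, Measure.restrict_apply_univ]; exact measure_Ioo_lt_top⟩
  have hk_int : Integrable k μT := by
    refine ⟨hk_meas, (hasFiniteIntegral_const (M * G)).mono ?_⟩
    filter_upwards [hk_bd] with τ hτ
    rw [Real.norm_eq_abs, abs_of_nonneg (hk0 τ), Real.norm_eq_abs, abs_of_nonneg (mul_nonneg hM0 hG0)]
    exact hτ
  -- the comparison integrand `q τ = √(2 m τ) k τ`
  set q : ℝ → ℝ := fun τ => Real.sqrt (2 * m τ) * k τ with hqdef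
  have hq0 : ∀ τ, 0 ≤ q τ := fun τ => mul_nonneg (Real.sqrt_nonneg _) (hk0 τ)
  have hm_meas : AEStronglyMeasurable m μT := by
    have h1 : Integrable (fun t => ∫ x, θ t x * h x) μT :=
      (hθ.integrable_mul_continuous hh.continuous).integral_prod_left
    have h2 : (fun t => ∫ x, h x * θ t x) = fun t => ∫ x, θ t x * h x := by
      funext t; exact integral_congr_ae (Eventually.of_forall fun x => mul_comm _ _)
    have h3 : AEStronglyMeasurable (fun t => ∫ x, h x * θ t x) μT := by
      rw [h2]; exact h1.aestronglyMeasurable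
    exact aestronglyMeasurable_const.sub h3
  have hm_bd : ∀ᵐ τ ∂μT, m τ ≤ 2 * L := by
    filter_upwards [hθ.ae_memLp_two, hcontr] with τ hmem hcon
    have hcs := integral_mul_le_sqrt_mul_sqrt_of_memLp hmem.neg hhL2
    have h1 : Real.sqrt (∫ x, (-θ τ x) ^ 2) ≤ Real.sqrt L := by
      refine Real.sqrt_le_sqrt ?_
      have : (fun x => (-θ τ x) ^ 2) = fun x => θ τ x ^ 2 := by funext x; ring
      rw [this]; exact hcon
    have e : -(∫ x, h x * θ τ x) = ∫ x, (-θ τ x) * h x := by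
      rw [← integral_neg]
      exact integral_congr_ae (Eventually.of_forall fun x => by ring)
    have h2 : ∫ x, (-θ τ x) * h x ≤ Real.sqrt L * Real.sqrt L :=
      hcs.trans (mul_le_mul h1 le_rfl (Real.sqrt_nonneg _) (Real.sqrt_nonneg _))
    rw [Real.mul_self_sqrt hL0] at h2
    simp only [hmdef]
    linarith
  have hq_int : Integrable q μT := by
    have hqm : AEStronglyMeasurable q μT :=
      (Real.continuous_sqrt.comp_aestronglyMeasurable (hm_meas.const_mul 2)).mul hk_meas
    refine ⟨hqm, (hasFiniteIntegral_const (Real.sqrt (2 * (2 * L)) * (M * G))).mono ?_⟩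
    filter_upwards [hm_bd, hk_bd] with τ hmτ hkτ
    rw [Real.norm_eq_abs, abs_of_nonneg (hq0 τ), Real.norm_eq_abs,
      abs_of_nonneg (mul_nonneg (Real.sqrt_nonneg _) (mul_nonneg hM0 hG0))]
    exact mul_le_mul (Real.sqrt_le_sqrt (by linarith)) hkτ (hk0 τ) (Real.sqrt_nonneg _)
  -- `Ψ` and the integrated inequality
  set Ψ : ℝ → ℝ := fun s => κ * Real.sqrt L * Dh * s + ∫ τ in Ioc 0 s, q τ ∂μT with hΨdef
  have hstep3 : ∀ᵐ s ∂μT, m s ≤ Ψ s := by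
    filter_upwards [hid, ae_restrict_mem measurableSet_Ioo] with s hs hsT
    have hs0 : 0 < s := hsT.1
    rw [hs]
    have hsub : ∀ᵐ τ ∂(μT.restrict (Ioc 0 s)), -Φ τ ≤ κ * Real.sqrt L * Dh + q τ :=
      ae_restrict_of_ae (hpt.mono fun τ hτ => hτ.1)
    have h1 : ∫ τ in Ioc 0 s, -Φ τ ∂μT ≤ ∫ τ in Ioc 0 s, (κ * Real.sqrt L * Dh + q τ) ∂μT :=
      integral_mono_ae hΦint.neg.integrableOn ((integrable_const _).add hq_int).integrableOn hsub
    rw [integral_neg] at h1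
    have h2 : ∫ τ in Ioc 0 s, (κ * Real.sqrt L * Dh + q τ) ∂μT =
        κ * Real.sqrt L * Dh * μT.real (Ioc 0 s) + ∫ τ in Ioc 0 s, q τ ∂μT := by
      rw [integral_add (integrable_const _) hq_int.integrableOn, setIntegral_const, smul_eq_mul]
      ring
    have h3 : μT.real (Ioc 0 s) ≤ s := by
      rw [measureReal_def, hμT, Measure.restrict_apply measurableSet_Ioc]
      calc (volume (Ioc 0 s ∩ Ioo 0 T)).toReal ≤ (volume (Ioc (0 : ℝ) s)).toReal := by
            refine ENNReal.toReal_mono measure_Ioc_lt_top.ne (measure_mono inter_subset_left)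
        _ = s := by rw [Real.volume_Ioc, ENNReal.toReal_ofReal (by linarith), sub_zero]
    have h4 : 0 ≤ κ * Real.sqrt L * Dh := by positivity
    calc -∫ τ in Ioc 0 s, Φ τ ≤ κ * Real.sqrt L * Dh * μT.real (Ioc 0 s) + ∫ τ in Ioc 0 s, q τ ∂μT := by
          have : -∫ τ in Ioc 0 s, Φ τ = -∫ τ in Ioc 0 s, Φ τ ∂μT := by
            rw [hμT, Measure.restrict_restrict measurableSet_Ioc,
              inter_eq_self_of_subset_left (Ioc_subset_Ioo_right hsT.2 |>.trans subset_rfl)]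
          rw [this]; linarith
      _ ≤ Ψ s := by
          simp only [hΨdef]
          nlinarith [mul_le_mul_of_nonneg_left h3 h4]
  /- Step 4: `Ψ` is monotone, so `Ψ s ≤ 2 κ √L Dh s + 2 (∫_{(0,s]} k)²` for every `s ∈ (0,T)`. -/
  have hΨmono : ∀ {τ s : ℝ}, τ ≤ s → 0 ≤ τ → Ψ τ ≤ Ψ s := by
    intro τ s hτs hτ0
    simp only [hΨdef]
    have h1 : ∫ σ in Ioc 0 τ, q σ ∂μT ≤ ∫ σ in Ioc 0 s, q σ ∂μT :=
      setIntegral_mono_set hq_int.integrableOn (Eventually.of_forall hq0)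
        (Ioc_subset_Ioc_right hτs).eventuallyLE
    have h4 : 0 ≤ κ * Real.sqrt L * Dh := by positivity
    nlinarith [mul_le_mul_of_nonneg_left hτs h4]
  have hstep4 : ∀ s ∈ Ioo 0 T, Ψ s ≤ 2 * (κ * Real.sqrt L * Dh * s) + 2 * (∫ τ in Ioc 0 s, k τ ∂μT) ^ 2 := by
    intro s hs
    have hs0 : 0 < s := hs.1
    -- `∫_{(0,s]} q ≤ √(2 Ψ s) ∫_{(0,s]} k`
    have hae : ∀ᵐ τ ∂(μT.restrict (Ioc 0 s)), q τ ≤ Real.sqrt (2 * Ψ s) * k τ := by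
      have h1 : ∀ᵐ τ ∂(μT.restrict (Ioc 0 s)), m τ ≤ Ψ τ := ae_restrict_of_ae hstep3
      filter_upwards [h1, ae_restrict_mem measurableSet_Ioc] with τ hτ hτs
      have hΨτ : Ψ τ ≤ Ψ s := hΨmono hτs.2 hτs.1.le
      have : Real.sqrt (2 * m τ) ≤ Real.sqrt (2 * Ψ s) := Real.sqrt_le_sqrt (by linarith)
      exact mul_le_mul_of_nonneg_right this (hk0 τ)
    have hI : ∫ τ in Ioc 0 s, q τ ∂μT ≤ Real.sqrt (2 * Ψ s) * ∫ τ in Ioc 0 s, k τ ∂μT := by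
      rw [← integral_const_mul]
      exact integral_mono_ae hq_int.integrableOn (hk_int.const_mul _).integrableOn hae
    have hF0 : 0 ≤ ∫ τ in Ioc 0 s, k τ ∂μT := integral_nonneg fun τ => hk0 τ
    have ha0 : 0 ≤ κ * Real.sqrt L * Dh * s := by positivity
    have hΨle : Ψ s ≤ κ * Real.sqrt L * Dh * s + Real.sqrt (2 * Ψ s) * ∫ τ in Ioc 0 s, k τ ∂μT := by
      simp only [hΨdef] at hI ⊢
      linarith
    exact le_two_mul_add_of_le_add_sqrt_mul ha0 hΨle
  /- Conclusion. -/
  filter_upwards [hstep3, ae_restrict_mem measurableSet_Ioo] with s hs hsT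
  have h4 := hstep4 s hsT
  have e : ∫ τ in Ioc 0 s, k τ ∂μT = ∫ τ in Ioo (0 : ℝ) s, k τ := by
    rw [hμT, Measure.restrict_restrict measurableSet_Ioc,
      inter_eq_self_of_subset_left (Ioc_subset_Ioo_right hsT.2), integral_Ioc_eq_integral_Ioo]
  rw [e] at h4
  simp only [hmdef] at hs
  calc scalarL2Sq h - ∫ x, h x * θ s x = m s := rfl
    _ ≤ Ψ s := hs
    _ ≤ 2 * (κ * Real.sqrt L * Dh * s) + 2 * (∫ τ in Ioo (0 : ℝ) s, k τ) ^ 2 := h4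
    _ = 2 * κ * s * Real.sqrt (scalarL2Sq h) * Dh + 2 * (∫ τ in Ioo (0 : ℝ) s, k τ) ^ 2 := by
        rw [hLdef]; ring

end Summit.AnomalousDissipation.AnomalousDissipation.Theorems.FloorUpgrade.Negative

end
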